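import Literature.Barriers.CriticalPhenomena.SlabLimitUniformControlProofs
import Literature.Probability.Percolation.SlabGluingFact2
import HarnessLib

/-!
# The slab-critical staircase: `θ(p_c) = 0` on `ℤ³` as a statement about `θ_{ℤ³}` at the
# critical points of the centred slabs

Write `C_k = {-k ≤ x₀ ≤ k}` for the centred slab of `ℤ³` (`cslab`, `cslabGraph`, a translate of
`S_{2k} = ℤ² × {0,…,2k}`), `p_k := p_c(C_k)` for its critical point and `a_k := θ_{ℤ³}(p_k)` for the
density of the FULL lattice at the slab's critical point. The tree proves Grimmett–Marstrand for
slabs (`SprinklingRenormalisation_holds`: `p_k ↓ p_c(ℤ³)`), the Duminil-Copin–Sidoravicius–Tassion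
slab theorem (`DuminilCopinSidoraviciusTassion2016_holds`: `θ_{S_k}(p_c(S_k)) = 0`) and right
upper-semicontinuity of `θ` at a zero (`exists_theta_zd_lt_of_eq_zero`). From these:

* `criticalProb_cslab_antitone`, `tendsto_criticalProb_cslab` — the staircase `p_k` is
  non-increasing and converges to `p_c(ℤ³)`; `theta_slabCritical_antitone` — `a_k` is non-increasing.
* **`percolationContinuityZ3_iff_tendsto_theta_slabCritical`** — the conjunct is EQUIVALENT to
  `a_k → 0`, and (`…_iff_forall_exists_theta_slabCritical_le`) to `∀ ε > 0, ∃ k, a_k ≤ ε`: a normal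
  form of `θ(p_c) = 0` as a statement about `θ_{ℤ³}` at an explicit sequence of parameters, each of
  which is (weakly) supercritical. (→) is semicontinuity and Grimmett–Marstrand; (←) is monotonicity.
* `theta_cslab_criticalProb_eq_zero` — DST at the CENTRE of the centred slabs,
  `θ_{C_k}(0, p_k) = 0` for `k ≥ 1` (translation to `S_{2k}`, root-independence of `θ > 0` on the
  connected slab, the tree's DST theorem). Hence `a_k = θ_{ℤ³}(p_k) - θ_{C_k}(p_k)` is the SLAB
  DEFECT at the slab's own critical point, and the conjunct reads: the slab defect at slab-criticality
  tends to zero (`percolationContinuityZ3_iff_tendsto_slabDefect`).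
* `percolationContinuityZ3_of_uniform_slab_exhaustion` — the one-sided Dini form: if the slabs
  exhaust `θ` UNIFORMLY in `p` (`∀ ε ∃ k ∀ p, θ(p) ≤ θ_{C_k}(p) + ε`), the conjunct holds (DST makes
  the bound bite at `p = p_k`). The converse (conjunct ⇒ uniform exhaustion, by Dini's theorem on
  `[p_c, 1]` once `θ` and every `θ_{C_k}` are continuous there) is not formalised here.
* `uniformSlabModulus_iff_percolationContinuityZ3` — the hypothesis of DST 2016, Prop. 3 (a modulus
  `f`, `f(0⁺) = f(0) = 0`, with `θ_{C_k}(p) ≤ f(p - p_k)` for all widths `k ≥ 1`) is EQUIVALENT to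
  the conjunct, unconditionally: the barrier entry `SlabLimitUniformControlNarrow` gives the
  equivalence with `(∀ k ≥ 1, θ_{C_k}(p_k) = 0) ∧ θ(p_c) = 0`, and the first conjunct is now a
  theorem (`theta_cslab_criticalProb_eq_zero`).

Solo seat `solo-CriticalPhenomena-informed`, census `paper/sharpest-statement.md` §5c.6: a sixth
faithful reformulation of the conjunct (not a weakening) — in the jump world `a_k ↓ θ(p_c) > 0`.

References: G. Grimmett, *Percolation* (1999), Thm. (7.2) and (7.4) p. 148, Lemma (8.9) p. 203;
H. Duminil-Copin, V. Sidoravicius, V. Tassion, CPAM 69 (2016), arXiv:1401.7130, Thm. 1, Prop. 3, §2.4.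
-/

noncomputable section

namespace Summit.CriticalPhenomena.PercolationContinuityZ3.Theorems

open MeasureTheory Filter Topology
open Literature.Probability.Percolation Literature.Probability.LatticeModels
open Literature.Barriers.CriticalPhenomena

/-! ### The staircase `p_k = p_c(C_k)` -/

/-- `k ↦ p_c(C_k)` is non-increasing (wider slabs percolate more easily). -/
theorem criticalProb_cslab_antitone :
    Antitone fun k : ℕ => criticalProb (cslabGraph k) (cslabOrigin k) :=
  fun k₀ _k hk =>
    criticalProb_induce_anti theta_induce_mono_holds (zdGraph 3) (cslab_mono hk) 0 (zero_mem_cslab k₀)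

/-- `p_c(C_k) → p_c(ℤ³)` (Grimmett–Marstrand for slabs, as proved in the tree, with antitonicity). -/
theorem tendsto_criticalProb_cslab :
    Tendsto (fun k : ℕ => criticalProb (cslabGraph k) (cslabOrigin k)) atTop
      (𝓝 (criticalProb (zdGraph 3) (0 : Site 3))) := by
  have h := tendsto_atTop_ciInf criticalProb_cslab_antitone
    ⟨0, by rintro _ ⟨j, rfl⟩; exact (criticalProb_mem_Icc _ _).1⟩
  rwa [iInf_criticalProb_cslab_eq_criticalProb] at h

/-- `k ↦ a_k = θ_{ℤ³}(p_c(C_k))` is non-increasing. -/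
theorem theta_slabCritical_antitone :
    Antitone fun k : ℕ =>
      theta (zdGraph 3) (0 : Site 3) (criticalProbIOf (cslabGraph k) (cslabOrigin k)) :=
  fun _k₀ _k hk => theta_mono_holds (zdGraph 3) 0 (criticalProb_cslab_antitone hk)

/-- `θ_{ℤ³}(p_c) ≤ a_k` for every `k` (`p_c(ℤ³) ≤ p_c(C_k)` and monotonicity of `θ`). -/
theorem theta_criticalProbI_le_theta_slabCritical (k : ℕ) :
    theta (zdGraph 3) (0 : Site 3) (criticalProbI 3) ≤
      theta (zdGraph 3) (0 : Site 3) (criticalProbIOf (cslabGraph k) (cslabOrigin k)) :=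
  theta_mono_holds (zdGraph 3) 0 (criticalProb_le_criticalProb_cslab k)

/-! ### The conjunct as the vanishing of the staircase densities -/

/-- **`θ(p_c(ℤ³)) = 0 ↔ θ_{ℤ³}(p_c(C_k)) → 0`.** (→): right upper-semicontinuity of `θ` at the zero
`p_c` and `p_c(C_k) ↓ p_c` (Grimmett–Marstrand); (←): `θ(p_c) ≤ θ(p_c(C_k))` for every `k`. -/
theorem percolationContinuityZ3_iff_tendsto_theta_slabCritical :
    PercolationContinuityZ3 ↔
      Tendsto (fun k : ℕ =>
        theta (zdGraph 3) (0 : Site 3) (criticalProbIOf (cslabGraph k) (cslabOrigin k)))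
        atTop (𝓝 0) := by
  constructor
  · intro h
    rw [Metric.tendsto_atTop]
    intro ε hε
    obtain ⟨δ, hδ, hθ⟩ := exists_theta_zd_lt_of_eq_zero 3 (criticalProbI 3) h hε
    obtain ⟨k₀, hk₀⟩ :=
      criticalProb_cslab_le_of_sprinkling SprinklingRenormalisation_holds (half_pos hδ)
    refine ⟨k₀, fun k hk => ?_⟩
    have hanti : criticalProb (cslabGraph k) (cslabOrigin k) ≤
        criticalProb (cslabGraph k₀) (cslabOrigin k₀) := criticalProb_cslab_antitone hk
    have hlt : ((criticalProbIOf (cslabGraph k) (cslabOrigin k) : unitInterval) : ℝ) <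
        (criticalProbI 3 : ℝ) + δ := by
      show criticalProb (cslabGraph k) (cslabOrigin k) < criticalProb (zdGraph 3) (0 : Site 3) + δ
      linarith
    have hnn : 0 ≤ theta (zdGraph 3) (0 : Site 3)
        (criticalProbIOf (cslabGraph k) (cslabOrigin k)) := measureReal_nonneg
    rw [Real.dist_eq, sub_zero, abs_of_nonneg hnn]
    exact hθ _ hlt
  · intro h
    have h0 : theta (zdGraph 3) (0 : Site 3) (criticalProbI 3) ≤ 0 :=
      le_of_tendsto_of_tendsto' tendsto_const_nhds h theta_criticalProbI_le_theta_slabCritical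
    exact le_antisymm h0 measureReal_nonneg

/-- **`θ(p_c(ℤ³)) = 0 ↔ ∀ ε > 0, ∃ k, θ_{ℤ³}(p_c(C_k)) ≤ ε`** (the staircase densities are
non-increasing, so their limit is their infimum). -/
theorem percolationContinuityZ3_iff_forall_exists_theta_slabCritical_le :
    PercolationContinuityZ3 ↔
      ∀ ε : ℝ, 0 < ε → ∃ k : ℕ,
        theta (zdGraph 3) (0 : Site 3) (criticalProbIOf (cslabGraph k) (cslabOrigin k)) ≤ ε := by
  constructor
  · intro h ε hε
    obtain ⟨k₀, hk₀⟩ :=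
      (Metric.tendsto_atTop.1 (percolationContinuityZ3_iff_tendsto_theta_slabCritical.1 h)) ε hε
    refine ⟨k₀, ?_⟩
    have hnn : 0 ≤ theta (zdGraph 3) (0 : Site 3)
        (criticalProbIOf (cslabGraph k₀) (cslabOrigin k₀)) := measureReal_nonneg
    have := hk₀ k₀ le_rfl
    rw [Real.dist_eq, sub_zero, abs_of_nonneg hnn] at this
    exact this.le
  · intro h
    have key : ∀ ε : ℝ, 0 < ε → theta (zdGraph 3) (0 : Site 3) (criticalProbI 3) ≤ ε := by
      intro ε hε
      obtain ⟨k, hk⟩ := h ε hε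
      exact (theta_criticalProbI_le_theta_slabCritical k).trans hk
    have h0 : theta (zdGraph 3) (0 : Site 3) (criticalProbI 3) ≤ 0 :=
      le_of_forall_pos_le_add fun ε hε => by simpa using key ε hε
    exact le_antisymm h0 measureReal_nonneg

/-! ### DST at the centre of the centred slabs, and the slab-defect reading -/

/-- **No percolation in `C_k` at `p_c(C_k)`, from the centre** (`k ≥ 1`): the translation by
`k e₀` carries `C_k` onto `S_{2k}` (`induceShiftIso`; `p_c(S_{2k}) = p_c(C_k)`,
`criticalProb_slab_two_mul_eq_cslab`), the slab is connected (`slabGraph_reachable`) so `θ > 0`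
does not depend on the root (`theta_pos_of_reachable`), and `θ_{S_{2k}}(0, p_c(S_{2k})) = 0` is the
tree's Duminil-Copin–Sidoravicius–Tassion theorem. -/
theorem theta_cslab_criticalProb_eq_zero (k : ℕ) (hk : 0 < k) :
    theta (cslabGraph k) (cslabOrigin k) (criticalProbIOf (cslabGraph k) (cslabOrigin k)) = 0 := by
  have ψ : cslabGraph k ≃g slabGraph 3 (2 * k) :=
    induceShiftIso (Pi.single 0 (k : ℤ)) fun x => by
      show (-(k : ℤ) ≤ x 0 ∧ x 0 ≤ (k : ℤ)) ↔
        (0 : ℤ) ≤ (x + (Pi.single 0 (k : ℤ) : Site 3)) (0 : Fin 3) ∧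
          (x + (Pi.single 0 (k : ℤ) : Site 3)) (0 : Fin 3) ≤ ((2 * k : ℕ) : ℤ)
      simp only [Pi.add_apply, Pi.single_eq_same]
      push_cast
      omega
  have hpc : criticalProbIOf (cslabGraph k) (cslabOrigin k) =
      criticalProbIOf (slabGraph 3 (2 * k)) (slabOrigin 3 (2 * k)) :=
    Subtype.ext (criticalProb_slab_two_mul_eq_cslab k).symm
  have hDST := DuminilCopinSidoraviciusTassion2016_holds (2 * k) (by omega)
  have hroot : theta (slabGraph 3 (2 * k)) (ψ (cslabOrigin k))
      (criticalProbIOf (slabGraph 3 (2 * k)) (slabOrigin 3 (2 * k))) = 0 := by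
    by_contra hne
    have hpos : 0 < theta (slabGraph 3 (2 * k)) (ψ (cslabOrigin k))
        (criticalProbIOf (slabGraph 3 (2 * k)) (slabOrigin 3 (2 * k))) :=
      lt_of_le_of_ne measureReal_nonneg (Ne.symm hne)
    have h0 := theta_pos_of_reachable (slabGraph 3 (2 * k))
      (slabGraph_reachable 3 (2 * k) (slabOrigin 3 (2 * k)) (ψ (cslabOrigin k))) _ hpos
    exact absurd hDST (ne_of_gt h0)
  rw [hpc, ← theta_iso ψ (cslabOrigin k)]
  exact hroot

/-- **The conjunct as the vanishing of the slab defect at slab-criticality**: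
`θ(p_c(ℤ³)) = 0 ↔ θ_{ℤ³}(p_c(C_k)) - θ_{C_k}(p_c(C_k)) → 0` (the subtracted term vanishes for
`k ≥ 1` by `theta_cslab_criticalProb_eq_zero`). -/
theorem percolationContinuityZ3_iff_tendsto_slabDefect :
    PercolationContinuityZ3 ↔
      Tendsto (fun k : ℕ =>
        theta (zdGraph 3) (0 : Site 3) (criticalProbIOf (cslabGraph k) (cslabOrigin k)) -
          theta (cslabGraph k) (cslabOrigin k) (criticalProbIOf (cslabGraph k) (cslabOrigin k)))
        atTop (𝓝 0) := by
  rw [percolationContinuityZ3_iff_tendsto_theta_slabCritical]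
  refine Filter.tendsto_congr' (Filter.eventually_atTop.2 ⟨1, fun k hk => ?_⟩)
  simp only [theta_cslab_criticalProb_eq_zero k hk, sub_zero]

/-- **Uniform slab exhaustion implies the conjunct** (the one-sided Dini form): if for every
`ε > 0` some centred slab carries all but `ε` of the density at EVERY parameter,
`θ_{ℤ³}(p) ≤ θ_{C_k}(p) + ε` for all `p`, then `θ(p_c(ℤ³)) = 0` — evaluate at `p = p_c(C_{k+1})`,
where the slab term vanishes (DST) and `θ(p_c) ≤ θ(p)`. -/
theorem percolationContinuityZ3_of_uniform_slab_exhaustion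
    (h : ∀ ε : ℝ, 0 < ε → ∃ k : ℕ, ∀ p : unitInterval,
      theta (zdGraph 3) (0 : Site 3) p ≤ theta (cslabGraph k) (cslabOrigin k) p + ε) :
    PercolationContinuityZ3 := by
  refine percolationContinuityZ3_iff_forall_exists_theta_slabCritical_le.2 fun ε hε => ?_
  obtain ⟨k, hk⟩ := h ε hε
  refine ⟨k + 1, ?_⟩
  set q : unitInterval := criticalProbIOf (cslabGraph (k + 1)) (cslabOrigin (k + 1)) with hq
  calc theta (zdGraph 3) (0 : Site 3) q
      ≤ theta (cslabGraph k) (cslabOrigin k) q + ε := hk q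
    _ ≤ theta (cslabGraph (k + 1)) (cslabOrigin (k + 1)) q + ε := by
        have := theta_cslab_mono q (Nat.le_succ k)
        simpa using this
    _ = ε := by rw [hq, theta_cslab_criticalProb_eq_zero (k + 1) (Nat.succ_pos k), zero_add]

/-! ### DST 2016, Prop. 3: the uniform modulus is equivalent to the conjunct -/

/-- **Prop. 3's hypothesis (widths `k ≥ 1`) is equivalent to `θ(p_c(ℤ³)) = 0`**, unconditionally:
a modulus `f` with `f(0) = 0`, continuous at `0` from the right, and
`θ_{C_k}(p) ≤ f(p - p_c(C_k))` for all `k ≥ 1` and `p ≥ p_c(C_k)`, EXISTS iff the conjunct holds.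
The barrier entry `SlabLimitUniformControlNarrow` (with the tree's Grimmett–Marstrand theorem)
gives the equivalence with `(∀ k ≥ 1, θ_{C_k}(p_c(C_k)) = 0) ∧ θ(p_c) = 0`, and the first conjunct
is `theta_cslab_criticalProb_eq_zero`. "Roughly of the same difficulty as attacking the problem
directly on `ℤ³`" (DST 2016, after Prop. 3) is an equivalence of statements. -/
theorem uniformSlabModulus_iff_percolationContinuityZ3 :
    (∃ f : ℝ → ℝ, ContinuousWithinAt f (Set.Ici 0) 0 ∧ f 0 = 0 ∧
        ∀ k ∈ Set.Ici (1 : ℕ), ∀ p : unitInterval,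
          criticalProb (cslabGraph k) (cslabOrigin k) ≤ p →
            theta (cslabGraph k) (cslabOrigin k) p ≤
              f ((p : ℝ) - criticalProb (cslabGraph k) (cslabOrigin k))) ↔
      PercolationContinuityZ3 := by
  rw [SlabLimitUniformControlNarrow_of_sprinkling SprinklingRenormalisation_holds (Set.Ici 1)
    (Set.Ici_infinite 1)]
  exact ⟨fun h => h.2, fun h => ⟨fun k hk => theta_cslab_criticalProb_eq_zero k hk, h⟩⟩

end Summit.CriticalPhenomena.PercolationContinuityZ3.Theorems

end
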